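import Literature.NumberTheory.EllipticCurves.AbelianVarietyBridgeFullProofs
import Literature.AlgebraicGeometry.Motives.AbelianVarietyExistence
import Literature.AlgebraicGeometry.Motives.AbelianVarietyRigidity
import Literature.AlgebraicGeometry.Motives.AlgPointsSeparate
import Literature.AlgebraicGeometry.Motives.DworkFamily
import Mathlib.AlgebraicGeometry.EllipticCurve.ModelsWithJ
import HarnessLib

/-!
# The automorphism `[i] : (x, y) ↦ (-x, iy)` of `y² = x³ + x` as an endomorphism of the abelian variety

Topic `Literature/NumberTheory/EllipticCurves` (namespace `Literature.NumberTheory.EllipticCurves`,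
sub-namespace `J1728` for the curve `y² = x³ + x` of `j`-invariant `1728`, Mathlib's
`WeierstrassCurve.ofJ1728`).  Silverman, *The Arithmetic of Elliptic Curves*, III.4 Example 4.4
(held copy, PDF p. 70): for a field `K` with `char K ≠ 2` and `i ∈ K`, `i² = -1`, the curve
`E : y² = x³ + x` carries the endomorphism `[i] : (x, y) ↦ (-x, iy)`, DEFINED OVER `K` («Clearly
`[i]` is defined over `K` if and only if `i ∈ K`»), with `[i] ∘ [i] (x, y) = (x, -y) = -(x, y)`, «so
`[i] ∘ [i] = [-1]`»; III.10.1 (PDF p. 97): for `B = 0` (`j = 1728`) the automorphisms are the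
substitutions `x = u²x′, y = u³y′` with `u⁴ = 1` (here `u = -i`).  This file constructs `[i]` on the
tree's REAL carrier — the plane cubic `E = V₊(Y²Z - X³ - XZ²) ⊂ ℙ²_K` with the chord–tangent group law
as a `K`-group scheme (`WeierstrassCurve.abelianVarietyOfAddHom` of `EllipticCurves/AbelianVarietyModelOfAddHom`,
assembled unconditionally in `EllipticCurves/AbelianVarietyBridgeFullProofs`):

* `J1728.abelianVariety K` — `E : y² = x³ + x` as an `AbelianVariety K` (`2 ∈ Kˣ`);
* `J1728.mulIVec i = (1, -i, -1)` and the invariance of the Weierstrass form `Y²Z - X³ - XZ²` under the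
  diagonal substitution `(X, Y, Z) ↦ (X, -iY, -Z)` (`aeval_diagSubst_mulIVec_polynomial`); projectively
  `[X : -iY : -Z] = [-X : iY : Z]`, i.e. `(x, y) ↦ (-x, iy)` on the affine chart;
* `J1728.mulIOver hi : E ⟶ E` — the restriction to `E ⊂ ℙ²_K` of the diagonal projective
  transformation `diag(1, -i, -1)` (the tree's `SmoothHypersurface.substLift`, Hartshorne II Ex. 3.11 (d)
  / Example 7.1.1), with its action on homogeneous coordinates (`map_mulIOver_schemePoint`); it fixes
  `O = [0 : 1 : 0]` (`oneHom_comp_mulIOver`), hence is a HOMOMORPHISM of group schemes by rigidity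
  (Mumford, *Abelian Varieties* §4 Cor. 1 = the tree's `isMonHom_of_one_comp`);
* `J1728.mulI hi : abelianVariety K ⟶ abelianVariety K` — `[i]` as an endomorphism of the abelian
  variety, and **`mulI_comp_mulI : [i] ≫ [i] = -𝟙`** (checked on `K̄`-points, which separate morphisms
  out of a reduced `K`-scheme of finite type, `SchemeOver.hom_ext_of_forall_algPoints`:
  `diag(1, -i, -1)² = diag(1, -1, 1)` is the negation `[X : Y : Z] ↦ [X : -Y : Z]` of `E`,
  `WeierstrassCurve.negHom`, which is the inverse of the group scheme);
* `aeval_mulI_X_sq_add_one : (X² + 1)([i]) = 0` in `End E` — the form consumed by the CM-type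
  realisation over `ℚ(i)` (`NumberTheory/ComplexMultiplication/CMTypeRealisationOverNumberField`).

Everything is a definition with a body or a theorem; no named fact is introduced (D-0026).
Template: `HodgeTheory/EisensteinCurveSqrtMinusThree` (`WeilSquare.rotOver`, `WeilSquare.rot`: the
automorphism `[ω]` of `y² = x³ + B` over `ℂ` by the same device).

## References

* [SilvermanAEC2009] J. H. Silverman, *The Arithmetic of Elliptic Curves*, 2nd ed., GTM 106 (2009):
  III.4 Example 4.4, III.10.1, III.3.6.
* [MumfordAV1970] D. Mumford, *Abelian Varieties* (1970), §4 (rigidity; Cor. 1).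
* [Hartshorne1977] R. Hartshorne, *Algebraic Geometry* (1977), II Ex. 2.14, II Ex. 3.11 (d),
  II Example 7.1.1; IV Example 4.20.1 (`y² = x³ - x` has complex multiplication by `i`).
-/

noncomputable section

open CategoryTheory AlgebraicGeometry MonoidalCategory CartesianMonoidalCategory MvPolynomial
open scoped MonObj
open Literature.AlgebraicGeometry.Motives
open WeierstrassCurve (ofJ1728)

universe u

namespace Literature.NumberTheory.EllipticCurves

namespace J1728

variable (K : Type u) [Field K]

attribute [local instance] MvPolynomial.gradedAlgebra ProjBaseChange.algebraBase

/-! ### The curve `E : y² = x³ + x` as an abelian variety over `K` -/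

section AV

variable [Fact (IsUnit (2 : K))]

/-- **`E : y² = x³ + x` as an abelian variety over `K`** (`2 ∈ Kˣ`, so that `Δ = -64 ≠ 0`): the smooth
plane cubic of Mathlib's `WeierstrassCurve.ofJ1728 K` with the chord–tangent addition morphism and the
negation morphism (the tree's `abelianVarietyOfAddHom`; Silverman, *AEC* III.3.6).
[cite: SilvermanAEC2009, III.3.6] -/
def abelianVariety : AbelianVariety K :=
  (ofJ1728 K).abelianVarietyOfAddHom (ofJ1728 K).addHom (ofJ1728 K).negHom
    (ofJ1728 K).lift_pointEquiv_comp_addHom (ofJ1728 K).pointEquiv_comp_negHom_geom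

/-- The underlying `K`-scheme of `E` is the Weierstrass plane cubic of `ofJ1728 K` (`rfl`).
[cite: SilvermanAEC2009, III.3.1(c)] -/
theorem abelianVariety_X : (abelianVariety K).X = (ofJ1728 K).scheme := rfl

/-- `dim E = 1`. [cite: SilvermanAEC2009, III.3.1(c)] -/
theorem dim_abelianVariety : (abelianVariety K).dim = 1 :=
  dim_abelianVarietyOfAddHom (ofJ1728 K) _ _ _ _

/-- The unit of the group scheme `E` is the section `O = [0 : 1 : 0]` (`rfl`). [cite: SilvermanAEC2009, III.2] -/
theorem one_eq_oneHom : η[(abelianVariety K).X] = (ofJ1728 K).oneHom := rfl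

/-- The inverse of the group scheme `E` is the negation morphism `[X : Y : Z] ↦ [X : -Y : Z]`
(`WeierstrassCurve.negHom`; `rfl`). [cite: SilvermanAEC2009, III.2.3] -/
theorem inv_eq_negHom : ι[(abelianVariety K).X] = (ofJ1728 K).negHom := rfl

end AV

/-! ### The diagonal substitution `(X, Y, Z) ↦ (X, -iY, -Z)` fixes `Y²Z - X³ - XZ²` -/

variable {K}

/-- The scaling vector `(1, -i, -1)` of the substitution `(X, Y, Z) ↦ (X, -iY, -Z)`; projectively
`[X : -iY : -Z] = [-X : iY : Z]`, Silverman's `[i] : (x, y) ↦ (-x, iy)`.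
[cite: SilvermanAEC2009, III.4 Example 4.4] -/
def mulIVec (i : K) : Fin 3 → K := ![1, -i, -1]

/-- `(1, -i, -1)₀ = 1`. [folklore] -/
@[simp] private theorem mulIVec_zero (i : K) : mulIVec i 0 = 1 := rfl

/-- `(1, -i, -1)₁ = -i`. [folklore] -/
@[simp] private theorem mulIVec_one (i : K) : mulIVec i 1 = -i := rfl

/-- `(1, -i, -1)₂ = -1`. [folklore] -/
@[simp] private theorem mulIVec_two (i : K) : mulIVec i 2 = -1 := rfl

/-- `i ≠ 0` when `i² = -1`. [folklore] -/
private theorem ne_zero_of_sq_eq_neg_one {i : K} (hi : i ^ 2 = -1) : i ≠ 0 := fun h => by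
  rw [h, zero_pow two_ne_zero] at hi
  exact one_ne_zero (neg_eq_zero.mp hi.symm)

/-- The entries of `(1, -i, -1)` are non-zero (`i² = -1`, so `i` is a primitive fourth root of unity).
[cite: SilvermanAEC2009, III.4 Example 4.4] -/
theorem mulIVec_ne_zero {i : K} (hi : i ^ 2 = -1) (j : Fin 3) : mulIVec i j ≠ 0 := by
  fin_cases j
  · exact one_ne_zero
  · exact neg_ne_zero.mpr (ne_zero_of_sq_eq_neg_one hi)
  · exact neg_ne_zero.mpr one_ne_zero

/-- Scaling a vector by `(1, -i, -1)`: `(x, y, z) ↦ (x, -iy, -z)` (`= [-x : iy : z]` projectively,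
Silverman's `(x, y) ↦ (-x, iy)`). [cite: SilvermanAEC2009, III.4 Example 4.4] -/
theorem mulIVec_mul_apply {L : Type u} [Field L] [Algebra K L] (i : K) (v : Fin 3 → L) :
    (fun j => algebraMap K L (mulIVec i j) * v j) = ![v 0, -(algebraMap K L i) * v 1, -v 2] := by
  funext j
  fin_cases j <;> simp

/-- Scaling twice by `(1, -i, -1)` is scaling by `(1, -1, 1)`: `(x, y, z) ↦ (x, -y, z)` (`i² = -1`).
[cite: SilvermanAEC2009, III.4 Example 4.4] -/
theorem mulIVec_mul_mulIVec_mul_apply {L : Type u} [Field L] [Algebra K L] {i : K} (hi : i ^ 2 = -1)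
    (v : Fin 3 → L) :
    (fun j => algebraMap K L (mulIVec i j) * (algebraMap K L (mulIVec i j) * v j)) = ![v 0, -v 1, v 2] := by
  have hi' : algebraMap K L i * algebraMap K L i = -1 := by
    rw [← map_mul, ← sq, hi, map_neg, map_one]
  funext j
  fin_cases j
  · simp
  · simp only [mulIVec_one, map_neg, Fin.mk_one, Matrix.cons_val_one, Matrix.cons_val_zero]
    linear_combination (v 1) * hi'
  · simp

/-- **The Weierstrass form `Y²Z - X³ - XZ²` of `y² = x³ + x` is invariant under
`(X, Y, Z) ↦ (X, -iY, -Z)`** (`(-i)²(-1) = 1` on `Y²Z`, `(-1)² = 1` on `XZ²`). [cite: SilvermanAEC2009, III.10.1] -/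
theorem aeval_diagSubst_mulIVec_polynomial {i : K} (hi : i ^ 2 = -1) :
    aeval (ProjectiveSpace.diagSubst (mulIVec i)) (ofJ1728 K).toProjective.polynomial =
      (ofJ1728 K).toProjective.polynomial := by
  have hX : ∀ j : Fin 3, aeval (ProjectiveSpace.diagSubst (mulIVec i)) (X j : MvPolynomial (Fin 3) K) =
      C (mulIVec i j) * X j := fun j => by
    rw [aeval_X, ProjectiveSpace.diagSubst_apply]
  have ha₁ : (ofJ1728 K).toProjective.a₁ = 0 := rfl
  have ha₂ : (ofJ1728 K).toProjective.a₂ = 0 := rfl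
  have ha₃ : (ofJ1728 K).toProjective.a₃ = 0 := rfl
  have ha₄ : (ofJ1728 K).toProjective.a₄ = 1 := rfl
  have ha₆ : (ofJ1728 K).toProjective.a₆ = 0 := rfl
  simp only [WeierstrassCurve.Projective.polynomial, map_sub, map_add, map_mul, map_pow, hX,
    mulIVec_zero, mulIVec_one, mulIVec_two, one_mul, ha₁, ha₂, ha₃, ha₄, ha₆, C_0, zero_mul, add_zero,
    map_neg, map_one]
  have hC : (C i : MvPolynomial (Fin 3) K) ^ 2 = -1 := by rw [← C_pow, hi, C_neg, C_1]
  linear_combination (-(X 1 : MvPolynomial (Fin 3) K) ^ 2 * X 2) * hC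

/-! ### The morphism `[i] : E ⟶ E` of `K`-schemes -/

section Scheme

variable {i : K} (hi : i ^ 2 = -1)

include hi

/-- **`[i]` as a `K`-morphism of schemes `E ⟶ E`**: the restriction to the cubic `E ⊂ ℙ²_K` of the
diagonal projective transformation `[X : Y : Z] ↦ [X : -iY : -Z]` (which fixes its equation), through the
reduced induced structure. [cite: Hartshorne1977, II Ex. 3.11 (d) and Example 7.1.1]
[cite: SilvermanAEC2009, III.4 Example 4.4] -/
def mulIOver : (ofJ1728 K).scheme ⟶ (ofJ1728 K).scheme :=
  SmoothHypersurface.substLift (n := 1) (ofJ1728 K).toProjective.polynomial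
    (ProjectiveSpace.diagSubst (mulIVec i)) (ProjectiveSpace.isHomogeneous_diagSubst _)
    (ProjectiveSpace.diagSubst fun j => (mulIVec i j)⁻¹) (ProjectiveSpace.isHomogeneous_diagSubst _)
    (ProjectiveSpace.aeval_diagSubst_diagSubst_inv (mulIVec_ne_zero hi))
    (aeval_diagSubst_mulIVec_polynomial hi)

/-- `[i]` is the restriction of `diag(1, -i, -1)`: `mulIOver ≫ ι = ι ≫ diagMap` (the defining property
of the morphism induced on the reduced closed subscheme). [cite: Hartshorne1977, II Ex. 3.11 (d)] -/
theorem mulIOver_comp_schemeι :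
    mulIOver hi ≫ (ofJ1728 K).schemeι =
      (ofJ1728 K).schemeι ≫ ProjectiveSpace.diagMap (mulIVec i) (mulIVec_ne_zero hi) :=
  SmoothHypersurface.substLift_comp_hypersurfaceι _ _ _ _ _ _ _

variable {L : Type u} [Field L] [Algebra K L]

/-- Scaling a solution of the Weierstrass equation of `E` by `(1, -i, -1)` gives a solution (the
substitution `x = u²x′, y = u³y′`, `u⁴ = 1`, preserves `y² = x³ + Ax`). [cite: SilvermanAEC2009, III.10.1] -/
theorem equation_mulIVec_mul {v : Fin 3 → L} (hv : ((ofJ1728 K).baseChange L).toProjective.Equation v) :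
    ((ofJ1728 K).baseChange L).toProjective.Equation fun j => algebraMap K L (mulIVec i j) * v j := by
  rw [← WeierstrassCurve.aeval_toProjective_polynomial_eq_zero_iff] at hv ⊢
  rw [← ProjectiveSpace.substVec_diagSubst]
  change aeval (fun j => aeval v (ProjectiveSpace.diagSubst (mulIVec i) j)) _ = 0
  rw [← ProjectiveSpace.aeval_substGraded _ (ProjectiveSpace.isHomogeneous_diagSubst _),
    ProjectiveSpace.substGraded_apply, aeval_diagSubst_mulIVec_polynomial hi, hv]

/-- A non-zero vector of homogeneous coordinates stays non-zero under scaling by `(1, -i, -1)` (so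
`[x : -iy : -z]` is a point). [cite: SilvermanAEC2009, III.4 Example 4.4] -/
theorem mulIVec_mul_ne_zero {v : Fin 3 → L} (hv : v ≠ 0) :
    (fun j => algebraMap K L (mulIVec i j) * v j) ≠ 0 := by
  intro h
  apply hv
  funext j
  have hj := congrFun h j
  simp only [Pi.zero_apply, mul_eq_zero] at hj
  exact hj.resolve_left (by
    rw [map_eq_zero_iff _ (algebraMap K L).injective]
    exact mulIVec_ne_zero hi j)

/-- **`[i]` on homogeneous coordinates: `[x : y : z] ↦ [x : -iy : -z]`** (`= [-x : iy : z]`).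
[cite: Hartshorne1977, II Ex. 2.14] [cite: SilvermanAEC2009, III.4 Example 4.4] -/
theorem map_mulIOver_schemePoint (v : Fin 3 → L) (hv : v ≠ 0)
    (hEq : ((ofJ1728 K).baseChange L).toProjective.Equation v) :
    AlgPoints.map (mulIOver hi) ((ofJ1728 K).schemePoint v hv hEq) =
      (ofJ1728 K).schemePoint (fun j => algebraMap K L (mulIVec i j) * v j)
        (mulIVec_mul_ne_zero hi hv) (equation_mulIVec_mul hi hEq) := by
  apply AlgPoints.map_injective_of_mono (ofJ1728 K).schemeι
  rw [← AlgPoints.map_comp_apply, mulIOver_comp_schemeι, AlgPoints.map_comp_apply,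
    WeierstrassCurve.map_schemeι_schemePoint, WeierstrassCurve.map_schemeι_schemePoint, AlgPoints.map_apply,
    ProjectiveSpace.pointOfVec_comp_diagMap]

/-- `[v] ≫ [i] = [x : -iy : -z]` (the same, written with `≫`). [cite: SilvermanAEC2009, III.4 Example 4.4] -/
theorem schemePoint_comp_mulIOver (v : Fin 3 → L) (hv : v ≠ 0)
    (hEq : ((ofJ1728 K).baseChange L).toProjective.Equation v) :
    (ofJ1728 K).schemePoint v hv hEq ≫ mulIOver hi =
      (ofJ1728 K).schemePoint (fun j => algebraMap K L (mulIVec i j) * v j)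
        (mulIVec_mul_ne_zero hi hv) (equation_mulIVec_mul hi hEq) :=
  map_mulIOver_schemePoint hi v hv hEq

/-- **`[i] ≫ [i]` on homogeneous coordinates is the negation `[x : y : z] ↦ [x : -y : z]`** of `E`
(`i² = -1`; Silverman: `[i] ∘ [i] (x, y) = (x, -y) = -(x, y)`). [cite: SilvermanAEC2009, III.4 Example 4.4] -/
theorem schemePoint_comp_mulIOver_comp_mulIOver [(ofJ1728 K).IsElliptic] (v : Fin 3 → L) (hv : v ≠ 0)
    (hEq : ((ofJ1728 K).baseChange L).toProjective.Equation v) :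
    ((ofJ1728 K).schemePoint v hv hEq ≫ mulIOver hi) ≫ mulIOver hi =
      (ofJ1728 K).schemePoint v hv hEq ≫ (ofJ1728 K).negHom := by
  rw [schemePoint_comp_mulIOver, schemePoint_comp_mulIOver, WeierstrassCurve.schemePoint_comp_negHom]
  apply WeierstrassCurve.schemePoint_congr
  rw [mulIVec_mul_mulIVec_mul_apply hi]
  funext j
  fin_cases j
  · simp [WeierstrassCurve.Projective.neg]
  · simp [WeierstrassCurve.Projective.neg, WeierstrassCurve.Projective.negY, WeierstrassCurve.ofJ1728]
  · simp [WeierstrassCurve.Projective.neg]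

/-- **`[i]` fixes the origin `O = [0 : 1 : 0]`** (`[0 : -i : 0] = [0 : 1 : 0]`), as `K`-points.
[cite: SilvermanAEC2009, III.4 Example 4.4] -/
theorem unitPoint_comp_mulIOver : (ofJ1728 K).unitPoint ≫ mulIOver hi = (ofJ1728 K).unitPoint := by
  rw [WeierstrassCurve.unitPoint, schemePoint_comp_mulIOver]
  refine (ofJ1728 K).schemePoint_eq_of_equiv ⟨Units.mk0 (-i) (neg_ne_zero.mpr (ne_zero_of_sq_eq_neg_one hi)), ?_⟩
    _ _ _ _
  funext j
  fin_cases j <;> simp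

/-- **`[i]` fixes the origin** (the unit section `oneHom : Spec K ⟶ E`). [cite: SilvermanAEC2009, III.4 Example 4.4] -/
theorem oneHom_comp_mulIOver : (ofJ1728 K).oneHom ≫ mulIOver hi = (ofJ1728 K).oneHom := by
  ext : 1
  rw [Over.comp_left, WeierstrassCurve.oneHom_left]
  exact congrArg CommaMorphism.left (unitPoint_comp_mulIOver hi)

end Scheme

/-! ### `[i]` as an endomorphism of the abelian variety `E`, and `[i] ≫ [i] = -𝟙` -/

section Endomorphism

variable [Fact (IsUnit (2 : K))] {i : K} (hi : i ^ 2 = -1)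

/-- `[i]` with source and target spelled as the scheme of the abelian variety `E` (definitionally
`mulIOver`; the spelling carries the group-scheme instance). [folklore] -/
def mulIOverX : (abelianVariety K).X ⟶ (abelianVariety K).X := mulIOver hi

/-- `[i]` fixes the origin (group-scheme form). [cite: SilvermanAEC2009, III.4 Example 4.4] -/
theorem one_comp_mulIOverX : η[(abelianVariety K).X] ≫ mulIOverX hi = η[(abelianVariety K).X] :=
  oneHom_comp_mulIOver hi

/-- `[i]` is a homomorphism of group schemes (rigidity: it fixes the origin; Mumford §4 Cor. 1, the
tree's `isMonHom_of_one_comp`). [cite: MumfordAV1970, §4 Cor. 1] -/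
instance isMonHom_mulIOverX : IsMonHom (mulIOverX hi) :=
  isMonHom_of_one_comp (A := abelianVariety K) (B := abelianVariety K) (mulIOverX hi) (one_comp_mulIOverX hi)

/-- **`[i] : E ⟶ E`, `(x, y) ↦ (-x, iy)`, as an endomorphism of the abelian variety `E : y² = x³ + x`
over `K`** (`i ∈ K`, `i² = -1`: «`[i]` is defined over `K` if and only if `i ∈ K`»; a morphism fixing
`O` is a homomorphism by rigidity). [cite: SilvermanAEC2009, III.4 Example 4.4] [cite: MumfordAV1970, §4 Cor. 1] -/
def mulI : abelianVariety K ⟶ abelianVariety K :=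
  InducedCategory.homMk (Grp.homMk (mulIOverX hi))

/-- The underlying morphism of schemes of `[i]` is `mulIOver`, `[x : y : z] ↦ [x : -iy : -z]` (`rfl`).
[cite: SilvermanAEC2009, III.4 Example 4.4] -/
theorem mulI_hom : (mulI hi).hom.hom.hom = mulIOver hi := rfl

/-- The underlying morphism of schemes of `-𝟙_E` is the inverse `ι` of the group scheme, i.e. the
negation morphism `[X : Y : Z] ↦ [X : -Y - a₁X - a₃Z : Z]` of the cubic. [cite: SilvermanAEC2009, III.2.3] -/
theorem neg_id_hom : (-𝟙 (abelianVariety K)).hom.hom.hom = (ofJ1728 K).negHom := by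
  rw [← inv_eq_negHom]
  change ((𝟙 (abelianVariety K).toGrp)⁻¹).hom.hom = ι[(abelianVariety K).X]
  rw [Grp.Hom.hom_hom_inv, GrpObj.inv_eq_inv]
  rfl

/-- **`[i] ≫ [i] = -𝟙` on `E : y² = x³ + x`** («`[i] ∘ [i] = [-1]`»; checked on `K̄`-points, which
separate morphisms out of the reduced finite-type `K`-scheme `E`: `[i][i][x : y : z] = [x : -y : z] = -[x : y : z]`).
[cite: SilvermanAEC2009, III.4 Example 4.4] [cite: MumfordAV1970, §4] -/
theorem mulI_comp_mulI : mulI hi ≫ mulI hi = -𝟙 (abelianVariety K) := by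
  apply AbelianVariety.hom_ext
  haveI : IsReduced (abelianVariety K).X.left := (ofJ1728 K).isReduced_scheme_left
  refine SchemeOver.hom_ext_of_forall_algPoints (AlgebraicClosure K) fun P => ?_
  obtain ⟨v, hv, hEq, rfl⟩ := (ofJ1728 K).exists_eq_schemePoint P
  rw [neg_id_hom, AbelianVariety.comp_hom]
  change ((ofJ1728 K).schemePoint v hv hEq ≫ mulIOver hi) ≫ mulIOver hi = _
  exact schemePoint_comp_mulIOver_comp_mulIOver hi v hv hEq

/-- `[i] * [i] = -1` in the ring `End E`. [cite: SilvermanAEC2009, III.4 Example 4.4] -/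
theorem mulI_mul_mulI :
    (show End (abelianVariety K) from mulI hi) * (show End (abelianVariety K) from mulI hi) = -1 := by
  rw [CategoryTheory.End.mul_def, mulI_comp_mulI]
  rfl

/-- **`[i]² + 1 = 0` in `End E`**: `[i]` is a root of `X² + 1 = Φ₄`, i.e. `ℤ[i] → End_K(E)`,
`i ↦ [i]` (Silverman: «There is thus a ring homomorphism `ℤ[i] → End(E)`»).
[cite: SilvermanAEC2009, III.4 Example 4.4] -/
theorem aeval_mulI_X_sq_add_one :
    Polynomial.aeval (R := ℤ) (show End (abelianVariety K) from mulI hi)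
      (Polynomial.X ^ 2 + 1 : Polynomial ℤ) = 0 := by
  rw [map_add, map_pow, Polynomial.aeval_X, map_one, sq, mulI_mul_mulI, neg_add_cancel]

/-- **Non-vacuity / summary: over every field `K` with `2 ∈ Kˣ` and a square root `i` of `-1` there is
a one-dimensional abelian variety over `K` with an endomorphism `u` DEFINED OVER `K` satisfying
`u ≫ u = -𝟙`** (`E : y² = x³ + x` with `[i]`). [cite: SilvermanAEC2009, III.4 Example 4.4] -/
theorem exists_abelianVariety_endomorphism_comp_self_eq_neg_id (hK : ∃ i : K, i ^ 2 = -1) :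
    ∃ (E : AbelianVariety K) (u : E ⟶ E), E.dim = 1 ∧ u ≫ u = -𝟙 E := by
  obtain ⟨i, hi⟩ := hK
  exact ⟨abelianVariety K, mulI hi, dim_abelianVariety K, mulI_comp_mulI hi⟩

end Endomorphism

end J1728

end Literature.NumberTheory.EllipticCurves

end
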